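import Literature.NumberTheory.Transcendental.KZIntervalPeriodProofs
import Literature.NumberTheory.Transcendental.SemialgebraicLineDeriv
import Literature.NumberTheory.Transcendental.KZCubicalCalculus
import Mathlib.Analysis.Calculus.Deriv.Inv
import Mathlib.Analysis.Calculus.Deriv.Mul
import Mathlib.Analysis.Calculus.Deriv.Pow

/-!
# `StokesGeneration` (stmt-KontsevichZagierPeriods-3586) — line `fibrewise_stokes`, stub `stub_rungAngularCertificate`

Registered rung stub R9 (rung 3) of the line `fibrewise_stokes` of the crux `StokesGeneration`
(route UnfoldedStokes): **the two-element divergence certificate for the angular derivative of a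
closed loop with positive real part** on the closed square `[0,1]²` (coordinates `z = x 0`,
`y = x 1`).

Let `P = A + iB` be a loop parametrised by `[0,1]`: `A > 0` on `[0,1]`, `B 0 = B 1 = 0`, `A`, `B`
continuous on `[0,1]` together with `A'`, `B'`, differentiable on `(0,1)` with these derivatives,
all four `ℚ`-semialgebraic as functions of `x 0` on the square, and let `γ` be real algebraic.
The angular derivative `Im (P'/P) = (A B' − A' B)/(A² + B²) = K/E₁` is the `y`-integral over
`[0,1]` of `∂_z` of the half-angle kernel `A B/(A² + B² y²)` (`∫₀¹ A B/(A² + B² y²) dy =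
arctan (B/A)`), up to an exact correction in the `y`-direction. Precisely, with
`E = A² + B² y² ≥ A² > 0` on the square, the two primitives
`G₀ = γ A B/E` (direction `0`), `G₁ = γ y K (1/E₁ − 1/E)` (direction `1`)
have fibre derivatives `D₀ = γ K (A² − B² y²)/E²`, `D₁ = γ K (1/E₁ − (A² − B² y²)/E²)` with
`D₀ + D₁ = γ K/E₁`, and ALL four boundary values `G₀|_{z=1}`, `G₀|_{z=0}`, `G₁|_{y=1}`,
`G₁|_{y=0}` vanish identically (`B 0 = B 1 = 0`, the factor `y`, and `E|_{y=1} = E₁`). Hence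
`γ K/E₁` is the sum of the two fibrewise Stokes elements `Dⱼ − (Gⱼ|_{xⱼ=1} − Gⱼ|_{xⱼ=0}) = Dⱼ`,
carried by the closed square with the continuous (hence integrable) `ℚ`-semialgebraic
integrands `Dⱼ`; `Gⱼ` is bounded on the compact square by continuity, and there is no kink set.
Semialgebraicity is closure of `ℚ`-semialgebraic functions under field operations
(Bochnak–Coste–Roy, Prop. 2.2.6) applied to the atoms `A (x 0)`, `B (x 0)`, `A' (x 0)`,
`B' (x 0)`, `x 1`, `γ`, `1`.

References: J. Ayoub, *Une version relative de la conjecture des périodes de Kontsevich–Zagier*,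
Ann. of Math. 181 (2015), Rem. 1.5; M. Kontsevich, D. Zagier, *Periods* (2001), §1.2;
J. Bochnak, M. Coste, M.-F. Roy, *Real Algebraic Geometry* (1998), Prop. 2.2.6.
-/

noncomputable section

-- `Summit.KontsevichZagierPeriods.KontsevichZagierPeriods.…` is the tree's mandated layout (single-conjunct summit).
set_option linter.dupNamespace false

namespace Summit.KontsevichZagierPeriods.KontsevichZagierPeriods.Cruxes.StokesGeneration.FibrewiseStokes

open MeasureTheory Set
open Literature.NumberTheory.Transcendental
open Literature.NumberTheory.Transcendental.KZ
open Literature.ModelTheory.ExponentialFields (IsSemialgebraic)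

/-! ## Calculus of the two primitives along their fibres -/

/-- Direction `0` (the half-angle kernel in `z`): for `A`, `B` differentiable at `s` with
derivatives `a`, `b` and `A s² + B s² c ≠ 0`,
`d/du [γ A B/(A² + B² c)]|_{u=s} = γ (A b − a B)(A² − B² c)/(A² + B² c)²`
(quotient rule; the numerator `(aB + Ab)(A² + B²c) − AB(2Aa + 2Bbc)` factors). [folklore] -/
theorem rungAng_hasDerivAt_dir0 {γ c s a b : ℝ} {A B : ℝ → ℝ} (hA : HasDerivAt A a s)
    (hB : HasDerivAt B b s) (hE : A s ^ 2 + B s ^ 2 * c ≠ 0) :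
    HasDerivAt (fun u => γ * (A u * B u) / (A u ^ 2 + B u ^ 2 * c))
      (γ * ((A s * b - a * B s) * (A s ^ 2 - B s ^ 2 * c)) / (A s ^ 2 + B s ^ 2 * c) ^ 2) s := by
  refine (((hA.fun_mul hB).const_mul γ).fun_div
    ((hA.fun_pow 2).fun_add ((hB.fun_pow 2).mul_const c)) hE).congr_deriv ?_
  congr 1
  simp only [Nat.cast_ofNat, Nat.reduceSub, pow_one]
  ring

/-- Direction `1` (the exact correction in `y`): wherever `p + q s² ≠ 0`,
`d/du [γ u k (1/e − 1/(p + q u²))]|_{u=s} = γ k (1/e − (p − q s²)/(p + q s²)²)`, since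
`d/du [u/(p + q u²)] = (p − q u²)/(p + q u²)²`. [folklore] -/
theorem rungAng_hasDerivAt_dir1 {γ k e p q s : ℝ} (hE : p + q * s ^ 2 ≠ 0) :
    HasDerivAt (fun u => γ * u * k * (1 / e - 1 / (p + q * u ^ 2)))
      (γ * k * (1 / e - (p - q * s ^ 2) / (p + q * s ^ 2) ^ 2)) s := by
  have h1 : HasDerivAt (fun u => p + q * u ^ 2) (q * (((2:ℕ) : ℝ) * s ^ (2 - 1))) s :=
    ((hasDerivAt_pow 2 s).const_mul q).const_add p
  have h2 : HasDerivAt (fun u => γ * u * k) (γ * 1 * k) s :=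
    ((hasDerivAt_id' s).const_mul γ).mul_const k
  refine (h2.fun_mul ((hasDerivAt_const s (1 / e)).fun_sub
    ((hasDerivAt_const s (1:ℝ)).fun_div h1 hE))).congr_deriv ?_
  simp only [Nat.cast_ofNat, Nat.reduceSub, pow_one]
  generalize hF : p + q * s ^ 2 = F at hE ⊢
  linear_combination (γ * k * F⁻¹) * mul_inv_cancel₀ hE + (γ * k * F⁻¹ ^ 2) * hF

/-! ## The certificate -/

/-- **Registered stub `stub_rungAngularCertificate` (rung 3, R9): the two-element divergence
certificate for the angular derivative of a closed loop with positive real part.** If `A > 0` on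
`[0,1]`, `B 0 = B 1 = 0`, `A`, `B` are differentiable on `(0,1)` with derivatives `A'`, `B'`, all
four continuous on `[0,1]` and `ℚ`-semialgebraic (as functions of `x 0` on the square), and `γ` is
real algebraic, then `γ · (A B' − A' B)/(A² + B²)` (a function of `x 0` on `[0,1]²`) is the sum of
two fibrewise Stokes elements with primitives `G₀ = γ A B/(A² + B² x₁²)` (direction `0`) and
`G₁ = γ x₁ (A B' − A' B) (1/(A² + B²) − 1/(A² + B² x₁²))` (direction `1`), no kink set; all four
boundary terms vanish and `∂₀ G₀ + ∂₁ G₁ = γ (A B' − A' B)/(A² + B²)`. [cite: Ayoub2015, Rem. 1.5] -/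
theorem stub_rungAngularCertificate :
    ∀ (γ : ℝ) (A B A' B' : ℝ → ℝ), IsAlgebraic ℚ γ →
      IsSemialgebraicFunOn ℚ (Set.pi Set.univ (fun _ : Fin 2 => Set.Icc (0:ℝ) 1)) (fun x => A (x 0)) →
      IsSemialgebraicFunOn ℚ (Set.pi Set.univ (fun _ : Fin 2 => Set.Icc (0:ℝ) 1)) (fun x => B (x 0)) →
      IsSemialgebraicFunOn ℚ (Set.pi Set.univ (fun _ : Fin 2 => Set.Icc (0:ℝ) 1)) (fun x => A' (x 0)) →
      IsSemialgebraicFunOn ℚ (Set.pi Set.univ (fun _ : Fin 2 => Set.Icc (0:ℝ) 1)) (fun x => B' (x 0)) →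
      (∀ u ∈ Set.Icc (0:ℝ) 1, 0 < A u) → B 0 = 0 → B 1 = 0 →
      ContinuousOn A (Set.Icc (0:ℝ) 1) → ContinuousOn B (Set.Icc (0:ℝ) 1) →
      ContinuousOn A' (Set.Icc (0:ℝ) 1) → ContinuousOn B' (Set.Icc (0:ℝ) 1) →
      (∀ u ∈ Set.Ioo (0:ℝ) 1, HasDerivAt A (A' u) u) → (∀ u ∈ Set.Ioo (0:ℝ) 1, HasDerivAt B (B' u) u) →
      ∃ (G D : Fin 2 → (Fin 2 → ℝ) → ℝ) (q : Fin 2 → IntegralRep 2),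
        (∀ j, IsSemialgebraicFunOn ℚ (Set.pi Set.univ (fun _ : Fin 2 => Set.Icc (0:ℝ) 1)) (G j) ∧
          IsSemialgebraicFunOn ℚ (Set.pi Set.univ (fun _ : Fin 2 => Set.Icc (0:ℝ) 1)) (D j) ∧
          (∃ B : ℝ, ∀ x ∈ Set.pi Set.univ (fun _ : Fin 2 => Set.Icc (0:ℝ) 1), |(G j) x| ≤ B) ∧
          (∀ x ∈ Set.pi Set.univ (fun _ : Fin 2 => Set.Icc (0:ℝ) 1),
            ContinuousOn (fun s : ℝ => (G j) (Function.update x j s)) (Set.Icc (0:ℝ) 1)) ∧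
          (∀ x ∈ Set.pi Set.univ (fun _ : Fin 2 => Set.Icc (0:ℝ) 1), x j ∈ Set.Ioo (0:ℝ) 1 →
            HasDerivAt (fun s : ℝ => (G j) (Function.update x j s)) ((D j) x) (x j))) ∧
        (∀ j, (q j).domain = Set.pi Set.univ (fun _ : Fin 2 => Set.Icc (0:ℝ) 1) ∧
          ∀ x ∈ Set.pi Set.univ (fun _ : Fin 2 => Set.Icc (0:ℝ) 1), (q j).integrand x =
            D j x - (G j (Function.update x j 1) - G j (Function.update x j 0))) ∧
        ∀ x ∈ Set.pi Set.univ (fun _ : Fin 2 => Set.Icc (0:ℝ) 1),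
          γ * ((A (x 0) * B' (x 0) - A' (x 0) * B (x 0)) / (A (x 0) ^ 2 + B (x 0) ^ 2)) =
            ∑ j, (q j).integrand x := by
  intro γ A B A' B' hγ hA hB hA' hB' hpos hB0 hB1 hAc hBc hA'c hB'c hderA hderB
  -- the closed square and what holds on it
  set S : Set (Fin 2 → ℝ) := Set.pi Set.univ (fun _ : Fin 2 => Set.Icc (0:ℝ) 1) with hS
  have hSsa : IsSemialgebraic ℚ S := by rw [hS, ← cube_eq_pi]; exact isSemialgebraic_cube
  have hSc : IsCompact S := isCompact_univ_pi fun _ => isCompact_Icc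
  have h10 : (1 : Fin 2) ≠ 0 := by decide
  have h01 : (0 : Fin 2) ≠ 1 := by decide
  have hmem : ∀ x ∈ S, ∀ i, x i ∈ Set.Icc (0:ℝ) 1 := fun x hx i => (Set.mem_univ_pi.mp hx) i
  have hApos : ∀ x ∈ S, 0 < A (x 0) := fun x hx => hpos _ (hmem x hx 0)
  -- the two denominators `E₁ = A² + B²` and `E = A² + B² y²` are positive on the square
  have hE1pos : ∀ x ∈ S, 0 < A (x 0) ^ 2 + B (x 0) ^ 2 := fun x hx =>
    add_pos_of_pos_of_nonneg (pow_pos (hApos x hx) 2) (sq_nonneg _)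
  have hEpos : ∀ x ∈ S, 0 < A (x 0) ^ 2 + B (x 0) ^ 2 * x 1 ^ 2 := fun x hx =>
    add_pos_of_pos_of_nonneg (pow_pos (hApos x hx) 2) (mul_nonneg (sq_nonneg _) (sq_nonneg _))
  have hE1ne : ∀ x ∈ S, A (x 0) ^ 2 + B (x 0) ^ 2 ≠ 0 := fun x hx => (hE1pos x hx).ne'
  have hEne : ∀ x ∈ S, A (x 0) ^ 2 + B (x 0) ^ 2 * x 1 ^ 2 ≠ 0 := fun x hx => (hEpos x hx).ne'
  have hE2ne : ∀ x ∈ S, (A (x 0) ^ 2 + B (x 0) ^ 2 * x 1 ^ 2) ^ 2 ≠ 0 := fun x hx =>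
    pow_ne_zero 2 (hEne x hx)
  -- moving one coordinate inside `[0,1]` stays in the square
  have hupd : ∀ x ∈ S, ∀ (j : Fin 2), ∀ s ∈ Set.Icc (0:ℝ) 1, Function.update x j s ∈ S := by
    intro x hx j s hs
    refine Set.mem_univ_pi.mpr fun i => ?_
    rcases eq_or_ne i j with rfl | hij
    · simpa using hs
    · rw [Function.update_of_ne hij]
      exact hmem x hx i
  -- semialgebraic atoms and building blocks on the square (BCR Prop. 2.2.6)
  have hx1sa : IsSemialgebraicFunOn ℚ S (fun x => x 1) := isSemialgebraicFunOn_apply hSsa 1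
  have hγsa : IsSemialgebraicFunOn ℚ S (fun _ => γ) :=
    isSemialgebraicFunOn_const_of_isAlgebraic hSsa hγ
  have h1sa : IsSemialgebraicFunOn ℚ S (fun _ => (1:ℝ)) :=
    isSemialgebraicFunOn_const_of_isAlgebraic hSsa isAlgebraic_one
  have hKsa : IsSemialgebraicFunOn ℚ S (fun x => A (x 0) * B' (x 0) - A' (x 0) * B (x 0)) :=
    (hA.fun_mul hB').fun_sub (hA'.fun_mul hB)
  have hE1sa : IsSemialgebraicFunOn ℚ S (fun x => A (x 0) ^ 2 + B (x 0) ^ 2) :=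
    (hA.fun_pow 2).fun_add (hB.fun_pow 2)
  have hEsa : IsSemialgebraicFunOn ℚ S (fun x => A (x 0) ^ 2 + B (x 0) ^ 2 * x 1 ^ 2) :=
    (hA.fun_pow 2).fun_add ((hB.fun_pow 2).fun_mul (hx1sa.fun_pow 2))
  have hNsa : IsSemialgebraicFunOn ℚ S (fun x => A (x 0) ^ 2 - B (x 0) ^ 2 * x 1 ^ 2) :=
    (hA.fun_pow 2).fun_sub ((hB.fun_pow 2).fun_mul (hx1sa.fun_pow 2))
  -- continuity atoms and building blocks on the square
  have hAS : ContinuousOn (fun x : Fin 2 → ℝ => A (x 0)) S :=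
    hAc.comp (continuous_apply 0).continuousOn fun x hx => hmem x hx 0
  have hBS : ContinuousOn (fun x : Fin 2 → ℝ => B (x 0)) S :=
    hBc.comp (continuous_apply 0).continuousOn fun x hx => hmem x hx 0
  have hA'S : ContinuousOn (fun x : Fin 2 → ℝ => A' (x 0)) S :=
    hA'c.comp (continuous_apply 0).continuousOn fun x hx => hmem x hx 0
  have hB'S : ContinuousOn (fun x : Fin 2 → ℝ => B' (x 0)) S :=
    hB'c.comp (continuous_apply 0).continuousOn fun x hx => hmem x hx 0
  have hx1S : ContinuousOn (fun x : Fin 2 → ℝ => x 1) S := (continuous_apply 1).continuousOn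
  have hKS : ContinuousOn (fun x : Fin 2 → ℝ => A (x 0) * B' (x 0) - A' (x 0) * B (x 0)) S :=
    (hAS.fun_mul hB'S).fun_sub (hA'S.fun_mul hBS)
  have hE1S : ContinuousOn (fun x : Fin 2 → ℝ => A (x 0) ^ 2 + B (x 0) ^ 2) S :=
    (hAS.pow 2).fun_add (hBS.pow 2)
  have hES : ContinuousOn (fun x : Fin 2 → ℝ => A (x 0) ^ 2 + B (x 0) ^ 2 * x 1 ^ 2) S :=
    (hAS.pow 2).fun_add ((hBS.pow 2).fun_mul (hx1S.pow 2))
  have hE2S : ContinuousOn (fun x : Fin 2 → ℝ => (A (x 0) ^ 2 + B (x 0) ^ 2 * x 1 ^ 2) ^ 2) S :=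
    hES.pow 2
  have hNS : ContinuousOn (fun x : Fin 2 → ℝ => A (x 0) ^ 2 - B (x 0) ^ 2 * x 1 ^ 2) S :=
    (hAS.pow 2).fun_sub ((hBS.pow 2).fun_mul (hx1S.pow 2))
  -- the witnesses
  set G0 : (Fin 2 → ℝ) → ℝ := fun x =>
    γ * (A (x 0) * B (x 0)) / (A (x 0) ^ 2 + B (x 0) ^ 2 * x 1 ^ 2) with hG0
  set D0 : (Fin 2 → ℝ) → ℝ := fun x =>
    γ * ((A (x 0) * B' (x 0) - A' (x 0) * B (x 0)) * (A (x 0) ^ 2 - B (x 0) ^ 2 * x 1 ^ 2)) /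
      (A (x 0) ^ 2 + B (x 0) ^ 2 * x 1 ^ 2) ^ 2 with hD0
  set G1 : (Fin 2 → ℝ) → ℝ := fun x =>
    γ * x 1 * (A (x 0) * B' (x 0) - A' (x 0) * B (x 0)) *
      (1 / (A (x 0) ^ 2 + B (x 0) ^ 2) - 1 / (A (x 0) ^ 2 + B (x 0) ^ 2 * x 1 ^ 2)) with hG1
  set D1 : (Fin 2 → ℝ) → ℝ := fun x =>
    γ * (A (x 0) * B' (x 0) - A' (x 0) * B (x 0)) *
      (1 / (A (x 0) ^ 2 + B (x 0) ^ 2) -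
        (A (x 0) ^ 2 - B (x 0) ^ 2 * x 1 ^ 2) / (A (x 0) ^ 2 + B (x 0) ^ 2 * x 1 ^ 2) ^ 2) with hD1
  -- semialgebraicity (closure under field operations, BCR Prop. 2.2.6)
  have hG0sa : IsSemialgebraicFunOn ℚ S G0 := (hγsa.fun_mul (hA.fun_mul hB)).div hEsa hEne
  have hD0sa : IsSemialgebraicFunOn ℚ S D0 :=
    (hγsa.fun_mul (hKsa.fun_mul hNsa)).div (hEsa.fun_pow 2) hE2ne
  have hG1sa : IsSemialgebraicFunOn ℚ S G1 :=
    ((hγsa.fun_mul hx1sa).fun_mul hKsa).fun_mul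
      ((h1sa.div hE1sa hE1ne).fun_sub (h1sa.div hEsa hEne))
  have hD1sa : IsSemialgebraicFunOn ℚ S D1 :=
    (hγsa.fun_mul hKsa).fun_mul
      ((h1sa.div hE1sa hE1ne).fun_sub (hNsa.div (hEsa.fun_pow 2) hE2ne))
  -- continuity on the square
  have hG0c : ContinuousOn G0 S := (continuousOn_const.fun_mul (hAS.fun_mul hBS)).div₀ hES hEne
  have hD0c : ContinuousOn D0 S :=
    (continuousOn_const.fun_mul (hKS.fun_mul hNS)).div₀ hE2S hE2ne
  have hG1c : ContinuousOn G1 S :=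
    ((continuousOn_const.fun_mul hx1S).fun_mul hKS).fun_mul
      ((continuousOn_const.div₀ hE1S hE1ne).fun_sub (continuousOn_const.div₀ hES hEne))
  have hD1c : ContinuousOn D1 S :=
    (continuousOn_const.fun_mul hKS).fun_mul
      ((continuousOn_const.div₀ hE1S hE1ne).fun_sub (hNS.div₀ hE2S hE2ne))
  -- packaged as `Fin 2`-families
  set G : Fin 2 → (Fin 2 → ℝ) → ℝ := ![G0, G1] with hG
  set D : Fin 2 → (Fin 2 → ℝ) → ℝ := ![D0, D1] with hD
  have hGsa : ∀ j, IsSemialgebraicFunOn ℚ S (G j) := Fin.forall_fin_two.2 ⟨hG0sa, hG1sa⟩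
  have hDsa : ∀ j, IsSemialgebraicFunOn ℚ S (D j) := Fin.forall_fin_two.2 ⟨hD0sa, hD1sa⟩
  have hGc : ∀ j, ContinuousOn (G j) S := Fin.forall_fin_two.2 ⟨hG0c, hG1c⟩
  have hDc : ∀ j, ContinuousOn (D j) S := Fin.forall_fin_two.2 ⟨hD0c, hD1c⟩
  -- all four boundary values vanish identically
  have hG_one : ∀ j x, G j (Function.update x j 1) = 0 := by
    refine Fin.forall_fin_two.2 ⟨fun x => ?_, fun x => ?_⟩
    · simp only [hG, hG0, Matrix.cons_val_zero, Function.update_self, hB1]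
      ring
    · simp only [hG, hG1, Matrix.cons_val_one, Matrix.cons_val_fin_one, Function.update_self,
        Function.update_of_ne h01]
      ring
  have hG_zero : ∀ j x, G j (Function.update x j 0) = 0 := by
    refine Fin.forall_fin_two.2 ⟨fun x => ?_, fun x => ?_⟩
    · simp only [hG, hG0, Matrix.cons_val_zero, Function.update_self, hB0]
      ring
    · simp only [hG, hG1, Matrix.cons_val_one, Matrix.cons_val_fin_one, Function.update_self]
      ring
  -- bounds on the compact square
  have hGbd : ∀ j, ∃ B : ℝ, ∀ x ∈ S, |G j x| ≤ B := fun j => by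
    obtain ⟨B, hB⟩ := hSc.exists_bound_of_continuousOn (hGc j)
    exact ⟨B, fun x hx => by simpa only [Real.norm_eq_abs] using hB x hx⟩
  -- continuity along closed fibres
  have hGfib : ∀ j, ∀ x ∈ S,
      ContinuousOn (fun s : ℝ => G j (Function.update x j s)) (Set.Icc (0:ℝ) 1) := by
    intro j x hx
    have hc : Continuous fun s : ℝ => Function.update x j s :=
      continuous_const.update j continuous_id
    exact (hGc j).comp hc.continuousOn fun s hs => hupd x hx j s hs
  -- derivatives along open fibres
  have hGder : ∀ j, ∀ x ∈ S, x j ∈ Set.Ioo (0:ℝ) 1 →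
      HasDerivAt (fun s : ℝ => G j (Function.update x j s)) (D j x) (x j) := by
    refine Fin.forall_fin_two.2 ⟨fun x hx hx0 => ?_, fun x hx _ => ?_⟩
    · have hfun : (fun s : ℝ => G 0 (Function.update x 0 s)) =
          fun s => γ * (A s * B s) / (A s ^ 2 + B s ^ 2 * x 1 ^ 2) := by
        funext s
        simp only [hG, hG0, Matrix.cons_val_zero, Function.update_self, Function.update_of_ne h10]
      have hDx : D 0 x = γ * ((A (x 0) * B' (x 0) - A' (x 0) * B (x 0)) *
          (A (x 0) ^ 2 - B (x 0) ^ 2 * x 1 ^ 2)) / (A (x 0) ^ 2 + B (x 0) ^ 2 * x 1 ^ 2) ^ 2 := by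
        simp only [hD, hD0, Matrix.cons_val_zero]
      rw [hfun, hDx]
      exact rungAng_hasDerivAt_dir0 (hderA _ hx0) (hderB _ hx0) (hEne x hx)
    · have hfun : (fun s : ℝ => G 1 (Function.update x 1 s)) =
          fun s => γ * s * (A (x 0) * B' (x 0) - A' (x 0) * B (x 0)) *
            (1 / (A (x 0) ^ 2 + B (x 0) ^ 2) - 1 / (A (x 0) ^ 2 + B (x 0) ^ 2 * s ^ 2)) := by
        funext s
        simp only [hG, hG1, Matrix.cons_val_one, Matrix.cons_val_fin_one, Function.update_self,
          Function.update_of_ne h01]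
      have hDx : D 1 x = γ * (A (x 0) * B' (x 0) - A' (x 0) * B (x 0)) *
          (1 / (A (x 0) ^ 2 + B (x 0) ^ 2) -
            (A (x 0) ^ 2 - B (x 0) ^ 2 * x 1 ^ 2) / (A (x 0) ^ 2 + B (x 0) ^ 2 * x 1 ^ 2) ^ 2) := by
        simp only [hD, hD1, Matrix.cons_val_one, Matrix.cons_val_fin_one]
      rw [hfun, hDx]
      exact rungAng_hasDerivAt_dir1 (hEne x hx)
  -- the two closed-square representations, with integrands `D j`
  let q : Fin 2 → IntegralRep 2 := fun j =>
    { domain := S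
      integrand := D j
      isSemialgebraic_domain := hSsa
      isSemialgebraicFunOn_integrand := hDsa j
      integrableOn := (hDc j).integrableOn_compact hSc }
  refine ⟨G, D, q, fun j => ⟨hGsa j, hDsa j, hGbd j, hGfib j, hGder j⟩,
    fun j => ⟨rfl, fun x _ => ?_⟩, fun x _ => ?_⟩
  · -- the integrand clause: boundary terms vanish
    show D j x = D j x - (G j (Function.update x j 1) - G j (Function.update x j 0))
    rw [hG_one, hG_zero, sub_zero, sub_zero]
  · -- the identity `γ K/E₁ = D₀ + D₁`
    show γ * ((A (x 0) * B' (x 0) - A' (x 0) * B (x 0)) / (A (x 0) ^ 2 + B (x 0) ^ 2)) = ∑ j, D j x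
    rw [Fin.sum_univ_two]
    simp only [hD, hD0, hD1, Matrix.cons_val_zero, Matrix.cons_val_one, Matrix.cons_val_fin_one]
    ring

end Summit.KontsevichZagierPeriods.KontsevichZagierPeriods.Cruxes.StokesGeneration.FibrewiseStokes
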